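import Mathlib.RingTheory.Regular.RegularSequence
import Mathlib.RingTheory.RegularLocalRing.Polynomial
import Mathlib.RingTheory.MvPolynomial.Homogeneous
import Mathlib.RingTheory.Localization.AtPrime.Basic
import Mathlib.RingTheory.Localization.Ideal
import Literature.RingTheory.Koszul.RegularSequenceFirstHomology
import Literature.RingTheory.RegularLocalRing.SopRegular
import Literature.RingTheory.KrullDimension.HomogeneousCommonZero
import Literature.RingTheory.MvPolynomial.HomogeneousDimension
import Literature.RingTheory.MvPolynomial.GradedNoetherNormalization
import HarnessLib

/-!
# A homogeneous system of parameters of `K[x₁, …, x_k]` is a regular sequence (Macaulay)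

Topic `Literature/RingTheory/MvPolynomial`. Let `K` be a field and `H₁, …, H_k ∈ S = K[x₁, …, x_k]`
be `k` forms of positive degrees such that every variable has a power in the ideal
`J = (H₁, …, H_k)` — equivalently `𝔪ᴺ ⊆ J` for the irrelevant ideal `𝔪 = (x₁, …, x_k)` and some
`N`, i.e. `J` is `𝔪`-primary, i.e. (over an algebraically closed field) the forms have only the
trivial common zero. Then

* `isWeaklyRegular_of_isHomogeneous_of_X_pow_mem_span` — `H₁, …, H_k` is a (weakly) regular
  sequence on `S` (Matsumura, *Commutative Ring Theory*, Thm. 17.4 (iii) with Thm. 17.8: the images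
  of the `H_i` in the regular local ring `S_𝔪` of dimension `k` are a system of parameters, hence an
  `S_𝔪`-sequence — the tree's `RegularLocalRing.SopRegular.isRegular_of_maximalIdeal_pow_le_ofList`;
  regularity descends to `S` because the prefix ideals `(H₁, …, H_{i-1})` are homogeneous: if
  `s · f ∈ I` with `I` homogeneous and `s(0) ≠ 0` then `f ∈ I`, `mem_of_mul_mem_of_constantCoeff_ne_zero`);
* `hasKoszulSyzygies_of_isHomogeneous_of_X_pow_mem_span` — hence `H₁(H; S) = 0`: every relation
  `Σ cᵢ Hᵢ = 0` is a combination of the trivial ones (Matsumura Thm. 16.5 (i), the tree's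
  `Koszul.hasKoszulSyzygies_of_isWeaklyRegular`);
* `eq_zero_of_sum_mul_eq_zero_of_isHomogeneous_lt` — in particular a relation `Σ cᵢ Hᵢ = 0` whose
  coefficients are forms of a degree `t` smaller than every `deg Hᵢ` is trivial, `cᵢ = 0`
  (each `cᵢ` lies in `J`, whose members have no homogeneous components below `min deg Hᵢ`).

This is the Literature-side, any-field, any-degrees form of the argument run over `ℂ` for forms of
one degree in `Summits/ValiantsHypothesis/…/BarrierLeverGradientGenericFibreCountMReg.lean`
(`HBasis.mreg_holds`, whose hypothesis is the point condition `V(H) = {0}`); that file is not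
touched. Consumers: the Jacobian ideal of a smooth form (`∂₀F, …, ∂_{m-1}F` is such a system), see
`Literature/Computability/AlgebraicComplexity/SmoothFormStabilizerFinite.lean`.

Theorem-only; no definitions, no named facts, no instances and no instance attributes
(homogeneity of an ideal is phrased as closure under `homogeneousComponent`; Mathlib's
`MvPolynomial.gradedAlgebra` is only summoned inside one proof by `letI`).

## References

* H. Matsumura, *Commutative Ring Theory*, CUP 1986: Thm. 16.5 (i) (Koszul homology of a regular
  sequence), Thm. 17.4 (iii) and Thm. 17.8 (systems of parameters of regular local rings are regular
  sequences). [Matsumura1987]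
* F. S. Macaulay, *The algebraic theory of modular systems* (1916), §§48–53 (H-bases; the
  original form of "homogeneous parameters are a regular sequence").
-/

noncomputable section

open MvPolynomial IsLocalRing RingTheory.Sequence

namespace Literature.RingTheory.MvPolynomial

universe u

variable {K : Type u} [Field K]

/-! ### Graded descent: `s · f ∈ I`, `I` homogeneous, `s(0) ≠ 0` ⟹ `f ∈ I` -/

section GradedDescent

variable {σ : Type*}

/-- Components of `q * u` below the degree of the form `u` vanish. [folklore] -/
private theorem homogeneousComponent_mul_eq_zero_of_lt_deg {q u : MvPolynomial σ K} {a n : ℕ}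
    (hu : u.IsHomogeneous a) (hn : n < a) : homogeneousComponent n (q * u) = 0 := by
  classical
  have hq : q * u = ∑ i ∈ Finset.range (q.totalDegree + 1), homogeneousComponent i q * u := by
    rw [← Finset.sum_mul, sum_homogeneousComponent]
  rw [hq, map_sum]
  refine Finset.sum_eq_zero fun i _ => ?_
  rw [homogeneousComponent_of_mem ((homogeneousComponent_isHomogeneous i q).mul hu), if_neg]
  omega

/-- Expansion of the degree-`n` component of a product `s * f` along the homogeneous components of
the first factor: `(s f)_n = Σ_{a ≤ n} f_{n-a} s_a`. [folklore] -/
private theorem homogeneousComponent_mul_eq_sum_range (s f : MvPolynomial σ K) (n : ℕ) :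
    homogeneousComponent n (s * f) = ∑ a ∈ Finset.range (s.totalDegree + 1),
      (if a ≤ n then homogeneousComponent (n - a) f * homogeneousComponent a s else 0) := by
  classical
  conv_lhs => rw [← sum_homogeneousComponent s, Finset.sum_mul, map_sum]
  refine Finset.sum_congr rfl fun a _ => ?_
  rw [mul_comm]
  split_ifs with h
  · exact homogeneousComponent_mul_of_isHomogeneous (homogeneousComponent_isHomogeneous a s) h
  · exact homogeneousComponent_mul_eq_zero_of_lt_deg (homogeneousComponent_isHomogeneous a s)
      (by omega)

/-- **Graded descent.** If `I` is a homogeneous ideal of `K[x]` (closed under taking homogeneous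
components), `s` has non-zero constant term and `s · f ∈ I`, then `f ∈ I` (induction on the degree:
`f_n s_0 = (s f)_n − Σ_{0<a≤n} f_{n-a} s_a ∈ I`). This is how regularity in the local ring `K[x]_𝔪`
descends to `K[x]` for homogeneous ideals (the same statement, over `ℂ` and with Mathlib's
`Ideal.IsHomogeneous`, is `HBasis.mem_of_mul_mem_of_constantCoeff_ne_zero` of the Summits file
`BarrierLeverGradientGenericFibreCountMReg.lean`; restated Literature-side so that Literature files
can use it). [cite: Matsumura1987, Thm. 17.4 (iii) (graded case)] -/
theorem mem_of_mul_mem_of_constantCoeff_ne_zero {I : Ideal (MvPolynomial σ K)}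
    (hI : ∀ p ∈ I, ∀ n : ℕ, homogeneousComponent n p ∈ I) {s f : MvPolynomial σ K}
    (hs : constantCoeff s ≠ 0) (h : s * f ∈ I) : f ∈ I := by
  classical
  suffices hcomp : ∀ n, homogeneousComponent n f ∈ I by
    rw [← sum_homogeneousComponent f]
    exact Ideal.sum_mem _ fun n _ => hcomp n
  intro n
  induction n using Nat.strong_induction_on with
  | _ n ih =>
    have hn : homogeneousComponent n (s * f) ∈ I := hI _ h n
    rw [homogeneousComponent_mul_eq_sum_range,
      Finset.sum_eq_add_sum_sdiff_singleton_of_mem (Finset.mem_range.2 (Nat.succ_pos _))] at hn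
    have hrest : (∑ a ∈ Finset.range (s.totalDegree + 1) \ {0},
        (if a ≤ n then homogeneousComponent (n - a) f * homogeneousComponent a s else 0)) ∈ I := by
      refine Ideal.sum_mem _ fun a ha => ?_
      have ha0 : a ≠ 0 := by
        rw [Finset.mem_sdiff, Finset.mem_singleton] at ha; exact ha.2
      split_ifs with hle
      · exact I.mul_mem_right _ (ih (n - a) (by omega))
      · exact I.zero_mem
    have h0 : homogeneousComponent n f * homogeneousComponent 0 s ∈ I := by
      have := I.sub_mem hn hrest
      simpa using this
    rw [homogeneousComponent_zero] at h0
    have hc : coeff 0 s ≠ 0 := by rwa [constantCoeff_eq] at hs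
    have : homogeneousComponent n f =
        homogeneousComponent n f * C (coeff 0 s) * C (coeff 0 s)⁻¹ := by
      rw [mul_assoc, ← C_mul, mul_inv_cancel₀ hc, C_1, mul_one]
    rw [this]
    exact I.mul_mem_right _ h0

/-- Elements of `𝔪ᵀ`, `𝔪 = ker constantCoeff` the irrelevant ideal, have no homogeneous components
of degree `< T`. [folklore] -/
private theorem homogeneousComponent_eq_zero_of_mem_ker_constantCoeff_pow :
    ∀ (T : ℕ) {p : MvPolynomial σ K},
      p ∈ (RingHom.ker (constantCoeff : MvPolynomial σ K →+* K)) ^ T →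
      ∀ t, t < T → homogeneousComponent t p = 0
  | 0, _, _, t, ht => absurd ht (Nat.not_lt_zero t)
  | T + 1, p, hp, t, ht => by
    classical
    rw [pow_succ'] at hp
    revert t
    refine Submodule.mul_induction_on hp (fun m hm q hq => ?_) (fun x y hx hy t ht => ?_)
    · intro t ht
      have hm0 : homogeneousComponent 0 m = 0 := by
        rw [homogeneousComponent_zero, ← constantCoeff_eq, (RingHom.mem_ker).1 hm, C_0]
      rw [homogeneousComponent_mul_eq_sum_range]
      refine Finset.sum_eq_zero fun a _ => ?_
      split_ifs with hle
      · rcases Nat.eq_zero_or_pos a with rfl | ha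
        · rw [hm0, mul_zero]
        · rw [homogeneousComponent_eq_zero_of_mem_ker_constantCoeff_pow T hq (t - a) (by omega),
            zero_mul]
      · rfl
    · rw [map_add, hx t ht, hy t ht, add_zero]

/-- If every variable has a power in the homogeneous ideal `I ⊆ K[x₁, …, x_m]`, then `𝔪ᴺ ⊆ I` for
some `N` (`𝔪 = (x₁, …, x_m)`): `I_t = S_t` for `t ≫ 0` (the tree's `idealDegree_eq_of_X_pow_mem`).
[folklore] -/
private theorem exists_ker_constantCoeff_pow_le_of_X_pow_mem {m : ℕ} {I : Ideal (MvPolynomial (Fin m) K)}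
    (hX : ∀ i, ∃ n : ℕ, (X i : MvPolynomial (Fin m) K) ^ n ∈ I) :
    ∃ N : ℕ, (RingHom.ker (constantCoeff : MvPolynomial (Fin m) K →+* K)) ^ N ≤ I := by
  classical
  obtain ⟨t₀, ht₀⟩ := idealDegree_eq_of_X_pow_mem hX
  refine ⟨t₀ + 1, fun p hp => ?_⟩
  rw [← sum_homogeneousComponent p]
  refine Ideal.sum_mem _ fun t _ => ?_
  by_cases ht : t < t₀ + 1
  · rw [homogeneousComponent_eq_zero_of_mem_ker_constantCoeff_pow (t₀ + 1) hp t ht]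
    exact I.zero_mem
  · have hmem : homogeneousComponent t p ∈ idealDegree I t := by
      rw [ht₀ t (by omega) (by omega)]; exact homogeneousComponent_mem t p
    exact ((mem_idealDegree).1 hmem).1

/-- The members of an ideal generated by forms of degrees `≥ a` have no homogeneous components of
degree `< a`. [folklore] -/
private theorem homogeneousComponent_eq_zero_of_mem_span_of_lt {ι : Type*} [Fintype ι]
    {H : ι → MvPolynomial σ K} {e : ι → ℕ} (hH : ∀ i, (H i).IsHomogeneous (e i)) {t : ℕ}
    (ht : ∀ i, t < e i) {g : MvPolynomial σ K} (hg : g ∈ Ideal.span (Set.range H)) :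
    homogeneousComponent t g = 0 := by
  classical
  obtain ⟨c, hc⟩ := Ideal.mem_span_range_iff_exists_fun.1 hg
  rw [← hc, map_sum]
  exact Finset.sum_eq_zero fun i _ => homogeneousComponent_mul_eq_zero_of_lt_deg (hH i) (ht i)

end GradedDescent

/-! ### Macaulay's theorem -/

section Macaulay

variable {k : ℕ}

/-- The ideal of the list `(H₁, …, H_k)` is the ideal generated by the range. [folklore] -/
private theorem ofList_ofFn_eq_span_range (H : Fin k → MvPolynomial (Fin k) K) :
    Ideal.ofList (List.ofFn H) = Ideal.span (Set.range H) := by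
  rw [Ideal.ofList]
  congr 1
  ext z
  simp [List.mem_ofFn']

/-- **Macaulay / Matsumura Thm. 17.4 (iii) for the graded polynomial ring: a homogeneous system of
parameters of `K[x₁, …, x_k]` is a regular sequence.** If `H₁, …, H_k` are forms of positive degrees
and every variable has a power in `(H₁, …, H_k)` (i.e. the ideal is primary to the irrelevant
ideal), then `H₁, …, H_k` is a weakly regular sequence on `K[x₁, …, x_k]`, for every field `K`.
Proof: in the regular local ring `K[x]_𝔪` (Mathlib `MvPolynomial.isRegularRing_of_isRegularRing`) of
dimension `k` (`height_ker_constantCoeff`) the images form a system of parameters, hence a regular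
sequence (`RegularLocalRing.SopRegular.isRegular_of_maximalIdeal_pow_le_ofList`); the prefix ideals
`(H₁, …, H_{i-1})` are homogeneous, so `H_i f ∈ (H₁, …, H_{i-1})` in `K[x]` gives, after clearing a
denominator `s ∉ 𝔪`, `s f ∈ (H₁, …, H_{i-1})` and then `f ∈ (H₁, …, H_{i-1})` by graded descent.
[cite: Matsumura1987, Thm. 17.4 (iii)] -/
theorem isWeaklyRegular_of_isHomogeneous_of_X_pow_mem_span (H : Fin k → MvPolynomial (Fin k) K)
    {e : Fin k → ℕ} (hH : ∀ i, (H i).IsHomogeneous (e i)) (he : ∀ i, 1 ≤ e i)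
    (hX : ∀ i, ∃ n : ℕ, (X i : MvPolynomial (Fin k) K) ^ n ∈ Ideal.span (Set.range H)) :
    IsWeaklyRegular (MvPolynomial (Fin k) K) (List.ofFn H) := by
  classical
  -- notation
  set J : Ideal (MvPolynomial (Fin k) K) := Ideal.span (Set.range H) with hJ_def
  set 𝔪 : Ideal (MvPolynomial (Fin k) K) :=
    RingHom.ker (constantCoeff : MvPolynomial (Fin k) K →+* K) with h𝔪_def
  haveI hmax : 𝔪.IsMaximal := isMaximal_ker_constantCoeff
  have hHm : ∀ i, H i ∈ 𝔪 := by
    intro i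
    rw [h𝔪_def, RingHom.mem_ker, constantCoeff_eq]
    refine (hH i).coeff_eq_zero ?_
    intro h0
    have h1 := he i
    simp at h0
    omega
  -- (B) `𝔪ᴺ ⊆ J`
  obtain ⟨N, hN⟩ := exists_ker_constantCoeff_pow_le_of_X_pow_mem hX
  -- (C) the regular local ring `R = K[x]_𝔪` of dimension `k`
  let R := Localization.AtPrime 𝔪
  let φ : MvPolynomial (Fin k) K →+* R := algebraMap _ R
  have hφm : ∀ i, φ (H i) ∈ maximalIdeal R := by
    intro i
    rw [← Localization.AtPrime.map_eq_maximalIdeal]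
    exact Ideal.mem_map_of_mem _ (hHm i)
  have hdim : ringKrullDim R = (k : WithBot ℕ∞) := by
    rw [IsLocalization.AtPrime.ringKrullDim_eq_height 𝔪 R, h𝔪_def,
      Literature.RingTheory.KrullDimension.height_ker_constantCoeff]
    rfl
  -- the full list is a regular sequence in `R`
  set L : List (MvPolynomial (Fin k) K) := List.ofFn H with hL_def
  have hQm : ∀ q ∈ L.map φ, q ∈ maximalIdeal R := by
    intro q hq
    rw [List.mem_map] at hq
    obtain ⟨r, hr, rfl⟩ := hq
    rw [hL_def, List.mem_ofFn'] at hr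
    obtain ⟨i, rfl⟩ := hr
    exact hφm i
  have hlen : ((L.map φ).length : WithBot ℕ∞) = ringKrullDim R := by
    rw [List.length_map, hL_def, List.length_ofFn, hdim]
  have hJL : Ideal.ofList L = J := by rw [hL_def, ofList_ofFn_eq_span_range]
  have hNloc : maximalIdeal R ^ N ≤ Ideal.ofList (L.map φ) := by
    rw [← Localization.AtPrime.map_eq_maximalIdeal, ← Ideal.map_pow, ← Ideal.map_ofList, hJL]
    exact Ideal.map_mono hN
  have hreg : IsWeaklyRegular R (L.map φ) :=
    (Literature.RingTheory.RegularLocalRing.isRegular_of_maximalIdeal_pow_le_ofList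
      hQm hlen hNloc).toIsWeaklyRegular
  -- (D) descend to `K[x]`, prefix by prefix
  refine (isWeaklyRegular_iff_Fin _ _).2 fun i => ?_
  refine (isSMulRegular_quotient_iff_mem_of_smul_mem _ _).2 fun f hf => ?_
  -- the prefix ideal and its homogeneity
  set P : Ideal (MvPolynomial (Fin k) K) := Ideal.ofList (L.take i) with hP_def
  have hPtop : (Ideal.ofList (L.take i) • ⊤ : Submodule (MvPolynomial (Fin k) K)
      (MvPolynomial (Fin k) K)) = Submodule.restrictScalars _ P := by
    rw [Ideal.smul_eq_mul, Ideal.mul_top]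
    rfl
  rw [hPtop, Submodule.restrictScalars_mem] at hf ⊢
  rw [smul_eq_mul] at hf
  have hPhom : ∀ p ∈ P, ∀ n : ℕ, homogeneousComponent n p ∈ P := by
    letI := MvPolynomial.gradedAlgebra (σ := Fin k) (R := K)
    have hP' : P.IsHomogeneous (homogeneousSubmodule (Fin k) K) := by
      rw [hP_def, Ideal.ofList]
      refine Ideal.homogeneous_span _ _ fun r hr => ?_
      have hr' : r ∈ L := List.mem_of_mem_take hr
      rw [hL_def, List.mem_ofFn'] at hr'
      obtain ⟨j, rfl⟩ := hr'
      exact ⟨e j, hH j⟩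
    exact fun p hp n => MvPolynomial.homogeneousComponent_mem_of_mem hP' hp n
  -- the `i`-th element of `L` is `H i`
  have hLi : L[(i : ℕ)] = H ⟨i, by simpa [hL_def] using i.2⟩ := by
    simp [hL_def, List.getElem_ofFn]
  simp only [Fin.getElem_fin] at hf
  rw [hLi] at hf
  -- regularity in `R` at position `i`
  have hiR : (i : ℕ) < (L.map φ).length := by rw [List.length_map]; exact i.2
  have hregi := (isWeaklyRegular_iff_Fin _ _).1 hreg ⟨i, hiR⟩
  have hLφi : (L.map φ)[(i : ℕ)] = φ (H ⟨i, by simpa [hL_def] using i.2⟩) := by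
    rw [List.getElem_map, hLi]
  simp only [Fin.getElem_fin] at hregi
  rw [hLφi, ← List.map_take, ← Ideal.map_ofList] at hregi
  -- push `H i * f ∈ P` to `R`
  have h1 : φ f ∈ (P.map φ • ⊤ : Submodule R R) := by
    refine mem_of_isSMulRegular_quotient_of_smul_mem hregi ?_
    rw [Ideal.smul_eq_mul, Ideal.mul_top, smul_eq_mul, ← map_mul]
    exact Ideal.mem_map_of_mem _ hf
  rw [Ideal.smul_eq_mul, Ideal.mul_top] at h1
  -- pull back with a denominator outside `𝔪`
  obtain ⟨⟨⟨a, ha⟩, ⟨s, hs⟩⟩, has⟩ :=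
    (IsLocalization.mem_map_algebraMap_iff 𝔪.primeCompl R).1 h1
  simp only at has
  rw [← map_mul] at has
  obtain ⟨⟨c, hc⟩, hcas⟩ := (IsLocalization.eq_iff_exists 𝔪.primeCompl R).1 has
  simp only at hcas
  have hcs : constantCoeff (c * s) ≠ 0 := by
    rw [map_mul]
    exact mul_ne_zero (fun h0 => hc ((RingHom.mem_ker).2 h0)) (fun h0 => hs ((RingHom.mem_ker).2 h0))
  refine mem_of_mul_mem_of_constantCoeff_ne_zero hPhom hcs ?_
  have : c * s * f = c * (f * s) := by ring
  rw [this, hcas]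
  exact Ideal.mul_mem_left _ _ ha

/-- **`H₁(H; K[x]) = 0` for a homogeneous system of parameters** (Matsumura Thm. 16.5 (i) on top of
Thm. 17.4 (iii)): every relation `Σ cᵢ Hᵢ = 0` among such forms is a combination of the trivial
relations `Hᵢ eⱼ − Hⱼ eᵢ`. [cite: Matsumura1987, Thm. 16.5 (i)] -/
theorem hasKoszulSyzygies_of_isHomogeneous_of_X_pow_mem_span (H : Fin k → MvPolynomial (Fin k) K)
    {e : Fin k → ℕ} (hH : ∀ i, (H i).IsHomogeneous (e i)) (he : ∀ i, 1 ≤ e i)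
    (hX : ∀ i, ∃ n : ℕ, (X i : MvPolynomial (Fin k) K) ^ n ∈ Ideal.span (Set.range H)) :
    Literature.RingTheory.Koszul.HasKoszulSyzygies H :=
  Literature.RingTheory.Koszul.hasKoszulSyzygies_of_isWeaklyRegular H
    (isWeaklyRegular_of_isHomogeneous_of_X_pow_mem_span H hH he hX)

/-- **Low-degree relations are trivial.** For a homogeneous system of parameters `H₁, …, H_k` of
`K[x₁, …, x_k]` and forms `c₁, …, c_k` of one degree `t < deg Hᵢ` (all `i`), `Σ cᵢ Hᵢ = 0` forces
`cᵢ = 0` for all `i`: by `H₁ = 0` each `cᵢ` lies in `(H₁, …, H_k)`, whose members have no component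
of degree `t`. (E.g. the partial derivatives of a smooth form of degree `d ≥ 3` admit no linear
syzygy.) [cite: Matsumura1987, Thm. 16.5 (i)] -/
theorem eq_zero_of_sum_mul_eq_zero_of_isHomogeneous_lt (H : Fin k → MvPolynomial (Fin k) K)
    {e : Fin k → ℕ} (hH : ∀ i, (H i).IsHomogeneous (e i)) (he : ∀ i, 1 ≤ e i)
    (hX : ∀ i, ∃ n : ℕ, (X i : MvPolynomial (Fin k) K) ^ n ∈ Ideal.span (Set.range H))
    {t : ℕ} (ht : ∀ i, t < e i) {c : Fin k → MvPolynomial (Fin k) K}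
    (hc : ∀ i, (c i).IsHomogeneous t) (hrel : ∑ i, c i * H i = 0) (i : Fin k) : c i = 0 := by
  have hmem : c i ∈ Ideal.span (Set.range H) :=
    (hasKoszulSyzygies_of_isHomogeneous_of_X_pow_mem_span H hH he hX).mem_span_range hrel i
  have h0 := homogeneousComponent_eq_zero_of_mem_span_of_lt hH ht hmem
  rwa [homogeneousComponent_of_mem (hc i), if_pos rfl] at h0

end Macaulay

end Literature.RingTheory.MvPolynomial

end
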